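import Summits.HodgeConjecture.CorCM.GaloisCyclicSemidirectTwoPowerGroup
import HarnessLib

/-!
# The two-sheet model of `C_p ⋊ C_{2^{a+2}}`: odd character sums are NORM FORMS `z · ρ(z)` over `ℚ(ζ_{2^{a+1}p})`

COR-CM (cell `pub-hodgecm2`), binder seat b04 (gen 25), count-neutral claim CYCLIC-SEMIDIRECT-TWO-POWER, part Ib — the
`2^{a+2}`-analogue of `CorCM/GaloisCyclicSemidirectEightTwoSheet` (`a = 1`): the Galois group
`G₀ = C_p ⋊ C_{2^{a+2}} = ⟨u, y | u^p = y^{2^{a+2}} = 1, y u y⁻¹ = u⁻¹⟩` (order `2^{a+2} p`, unique involution `c₀ = y^{2^{a+1}}`;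
`a = 0` is the dicyclic group `Dic_p`, `a = 1` is `C_p ⋊ C₈`).  KERNEL ONLY: theorems; no definition, no named fact, no `sorry`.
`HC_CM` is neither used nor claimed.

THE MECHANISM.  `A = ⟨y²⟩ × ⟨u⟩ ≅ ℤ/2^{a+1} × ℤ/p` is abelian of index `2`, `G₀ = A ⊔ A·y`, conjugation by `y` is
`θ(t, v) = (t, v⁻¹)`, `y² = q = (1, 0)`, `c₀ = (2^a, 0)`.  For an odd character `χ = ψ ⊗ λ` (`ψ(2^a) = −1`, so `ω = ψ(1)` is a
primitive `2^{a+1}`-th root of unity) and a ring map `ρ` out of a subfield `M ⊇ μ_{2^{a+1}p}` of `ℂ` fixing `μ_{2^{a+1}}` and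
inverting `μ_p`, ELEMENT BY ELEMENT `χ(t, −v) = ρ(χ(t, v))`, so the two-sheet determinant (`CorCM/TwoSheetAnnihilator`) is
  `Δ(χ) = Ŝ₁ ρ(Ŝ₁) − ω · Ŝ₂ ρ(Ŝ₂)`.
HYPOTHESIS `hN` («`ω` is not a quotient of norms»): `z₁ ρ(z₁) = ω z₂ ρ(z₂)`, `ω^{2^a} = −1 ⟹ z₁ = z₂ = 0`.  Under `hN`,
`Δ(χ) = 0` forces `Ŝ₁(χ) = Ŝ₂(χ) = 0`, so (`CorCM/CyclicHalfOddCharacterSums`, order `2^{a+1}·p`) both sheets are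
`C_p`-periodic: `u^{2^{a+1}}` is a left stabiliser.  `hN` is discharged for `p ≡ 2^{a+1} + 1 (mod 2^{a+2})` in part III
(`CorCM/CyclotomicTwoPowerPNormObstruction`).

Part Ia (`CorCM/GaloisCyclicSemidirectTwoPowerGroup`) supplies the group facts and the norm-form lemmas; this file is

* **`eq_zero_of_annihilated_cyclicSemidirect`** — the model theorem.

## References

* [Kubota1965] T. Kubota, Nagoya Math. J. 25 (1965) 113–120, §4 Lemma 2.
* [Dodson1984] B. Dodson, Trans. AMS 283 (1984) 1–32, §5.3.
* [FeinGordonSmith1971] B. Fein, B. Gordon, J. H. Smith, J. Number Theory 3 (1971), 310–315.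
-/

noncomputable section

open scoped BigOperators

namespace Summit.HodgeConjecture.CorCM.GaloisCyclicSemidirectTwoPower

open Literature.NumberTheory.ComplexMultiplication (IsCMTypeWith)
open Summit.HodgeConjecture.CorCM.CyclicTwoPower (mul_pow_mem_iff_of_sum_eq_zero)
open AddChar

/-! ## The two-sheet model theorem -/

section Model

variable {p a : ℕ} [Fact p.Prime]

/-- **THE MODEL THEOREM.**  `p` an odd prime; `G₀ = C_p ⋊ C_{2^{a+2}}` (`φ(1)` = inversion); `M ⊆ ℂ` a subfield containing
the `2^{a+1}p`-th roots of unity with a ring map `ρ : M → ℂ` fixing `μ_{2^{a+1}}` and inverting `μ_p`, such that no primitive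
`2^{a+1}`-th root of unity is a quotient of two «norms» `z ρ(z)` (`hN`).  If `S ⊆ G₀` is a CM set for
`c₀ = inr 2^{a+1} = y^{2^{a+1}}` and `u^{2^{a+1}} = inl 2^{a+1}` is not a left stabiliser of `S`, then every `c₀`-antisymmetric
`b : G₀ → ℚ` annihilated by all right translates of `S` is zero. [cite: Kubota1965, §4 Lemma 2] [cite: Dodson1984, §5.3] -/
theorem eq_zero_of_annihilated_cyclicSemidirect (hp2 : p ≠ 2)
    (φ : Multiplicative (ZMod (2 ^ (a + 2))) →* MulAut (Multiplicative (ZMod p)))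
    (hφ : ∀ v : Multiplicative (ZMod p), φ (Multiplicative.ofAdd 1) v = v⁻¹)
    (M : Subfield ℂ) (ρ : M →+* ℂ) (hM : ∀ z : ℂ, z ^ (2 ^ (a + 1) * p) = 1 → z ∈ M)
    (hρ2 : ∀ z : M, (z : ℂ) ^ 2 ^ (a + 1) = 1 → ρ z = z) (hρp : ∀ z : M, (z : ℂ) ^ p = 1 → ρ z = (z : ℂ)⁻¹)
    (hN : ∀ (z₁ z₂ : M) (ω : ℂ), ω ^ 2 ^ a = -1 → (z₁ : ℂ) * ρ z₁ = ω * ((z₂ : ℂ) * ρ z₂) →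
      (z₁ : ℂ) = 0 ∧ (z₂ : ℂ) = 0)
    (S : Finset (Multiplicative (ZMod p) ⋊[φ] Multiplicative (ZMod (2 ^ (a + 2)))))
    (hScm : ∀ g, SemidirectProduct.inr (Multiplicative.ofAdd ((2 ^ (a + 1) : ℕ) : ZMod (2 ^ (a + 2)))) * g ∈ S ↔ g ∉ S)
    (hstab : ¬ ∀ w, w ∈ S ↔ SemidirectProduct.inl (Multiplicative.ofAdd ((2 ^ (a + 1) : ℕ) : ZMod p)) * w ∈ S)
    (b : Multiplicative (ZMod p) ⋊[φ] Multiplicative (ZMod (2 ^ (a + 2))) → ℚ)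
    (hb : ∀ g, b (SemidirectProduct.inr (Multiplicative.ofAdd ((2 ^ (a + 1) : ℕ) : ZMod (2 ^ (a + 2)))) * g) = -b g)
    (hann : ∀ g, ∑ s ∈ S, b (s * g) = 0) : b = 0 := by
  classical
  have hp : p.Prime := Fact.out
  haveI : NeZero p := ⟨hp.ne_zero⟩
  haveI : NeZero (2 ^ (a + 2)) := ⟨by positivity⟩
  haveI : NeZero (2 ^ (a + 1)) := ⟨by positivity⟩
  haveI : Fact (1 < 2 ^ (a + 1)) := ⟨Nat.one_lt_two_pow (by omega)⟩
  haveI : Fintype (Multiplicative (ZMod p) ⋊[φ] Multiplicative (ZMod (2 ^ (a + 2)))) :=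
    Fintype.ofEquiv _ SemidirectProduct.equivProd.symm
  have hK : (2 : ℕ) ^ (a + 2) = 2 * 2 ^ (a + 1) := by rw [pow_succ]; ring
  have hK' : (2 : ℕ) ^ (a + 1) = 2 * 2 ^ a := by rw [pow_succ]; ring
  -- `2 ∈ ℤ/2^{a+2}` has order `2^{a+1}`
  have hpow2 : ∀ k : ℕ, Multiplicative.ofAdd (2 : ZMod (2 ^ (a + 2))) ^ k =
      Multiplicative.ofAdd ((2 * k : ℕ) : ZMod (2 ^ (a + 2))) :=
    fun k => by rw [← ofAdd_nsmul, nsmul_eq_mul, Nat.cast_mul, Nat.cast_ofNat, mul_comm]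
  have h24 : Multiplicative.ofAdd (2 : ZMod (2 ^ (a + 2))) ^ 2 ^ (a + 1) = 1 := by
    rw [hpow2, ← hK, ZMod.natCast_self]; rfl
  -- the abelian subgroup `⟨y²⟩ × ⟨u⟩ ≅ ℤ/2^{a+1} × ℤ/p`
  let f : Multiplicative (ZMod (2 ^ (a + 1))) × Multiplicative (ZMod p) →
      Multiplicative (ZMod p) ⋊[φ] Multiplicative (ZMod (2 ^ (a + 2))) :=
    fun w => ⟨w.2, Multiplicative.ofAdd (2 : ZMod (2 ^ (a + 2))) ^ (Multiplicative.toAdd w.1).val⟩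
  have hf_apply : ∀ w, f w = ⟨w.2, Multiplicative.ofAdd (2 : ZMod (2 ^ (a + 2))) ^ (Multiplicative.toAdd w.1).val⟩ :=
    fun w => rfl
  let i : Multiplicative (ZMod (2 ^ (a + 1))) × Multiplicative (ZMod p) →*
      Multiplicative (ZMod p) ⋊[φ] Multiplicative (ZMod (2 ^ (a + 2))) :=
    MonoidHom.mk' f fun w w' => by
      refine SemidirectProduct.ext ?_ ?_
      · simp only [hf_apply, SemidirectProduct.mul_left, Prod.snd_mul, phi_two_pow φ hφ]
      · simp only [hf_apply, SemidirectProduct.mul_right, Prod.fst_mul, toAdd_mul, ← pow_add]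
        rw [ZMod.val_add, ← pow_eq_pow_mod _ h24]
  have hi_apply : ∀ w, i w = ⟨w.2, Multiplicative.ofAdd (2 : ZMod (2 ^ (a + 2))) ^ (Multiplicative.toAdd w.1).val⟩ :=
    fun w => rfl
  have hval : ∀ t : Multiplicative (ZMod (2 ^ (a + 1))), (Multiplicative.toAdd t).val < 2 ^ (a + 1) :=
    fun t => ZMod.val_lt _
  have hinj2 : ∀ k k' : ℕ, k < 2 ^ (a + 1) → k' < 2 ^ (a + 1) →
      Multiplicative.ofAdd (2 : ZMod (2 ^ (a + 2))) ^ k = Multiplicative.ofAdd (2 : ZMod (2 ^ (a + 2))) ^ k' →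
        k = k' := by
    intro k k' hk hk' h
    rw [hpow2, hpow2, Equiv.apply_eq_iff_eq, ZMod.natCast_eq_natCast_iff', Nat.mod_eq_of_lt (by omega),
      Nat.mod_eq_of_lt (by omega)] at h
    omega
  have hne1 : ∀ k : ℕ, Multiplicative.ofAdd (2 : ZMod (2 ^ (a + 2))) ^ k ≠ Multiplicative.ofAdd 1 := by
    intro k h
    rw [hpow2, Equiv.apply_eq_iff_eq, show (1 : ZMod (2 ^ (a + 2))) = ((1 : ℕ) : ZMod (2 ^ (a + 2))) by norm_num] at h
    have h2 := congrArg (ZMod.castHom (show 2 ∣ 2 ^ (a + 2) from dvd_pow_self 2 (by omega)) (ZMod 2)) h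
    rw [map_natCast, map_natCast, ZMod.natCast_eq_natCast_iff'] at h2
    omega
  have hi : Function.Injective i := by
    rintro ⟨t, v⟩ ⟨t', v'⟩ h
    rw [hi_apply, hi_apply, SemidirectProduct.ext_iff] at h
    refine Prod.ext ?_ h.1
    have := hinj2 _ _ (hval t) (hval t') h.2
    exact Multiplicative.toAdd.injective (ZMod.val_injective _ this)
  -- the second sheet `i(A) · y`, `y = inr 1`
  set y : Multiplicative (ZMod p) ⋊[φ] Multiplicative (ZMod (2 ^ (a + 2))) :=
    SemidirectProduct.inr (Multiplicative.ofAdd (1 : ZMod (2 ^ (a + 2)))) with hy_def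
  have hy : y = ⟨1, Multiplicative.ofAdd 1⟩ := rfl
  have hx : ∀ w, i w ≠ y := fun ⟨t, v⟩ h => by
    rw [hi_apply, hy, SemidirectProduct.ext_iff] at h
    exact hne1 _ h.2
  have hcov : ∀ g : Multiplicative (ZMod p) ⋊[φ] Multiplicative (ZMod (2 ^ (a + 2))),
      (∃ w, g = i w) ∨ (∃ w, g = i w * y) := by
    rintro ⟨v, m⟩
    set n : ℕ := (Multiplicative.toAdd m).val with hn_def
    have hn8 : n < 2 ^ (a + 2) := ZMod.val_lt _
    have hk4 : ((n / 2 : ℕ) : ZMod (2 ^ (a + 1))).val = n / 2 := ZMod.val_natCast_of_lt (by omega)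
    have hm : m = Multiplicative.ofAdd (2 : ZMod (2 ^ (a + 2))) ^ (n / 2) *
        Multiplicative.ofAdd (1 : ZMod (2 ^ (a + 2))) ^ (n % 2) := by
      rw [← ofAdd_nsmul, ← ofAdd_nsmul, ← ofAdd_add, nsmul_eq_mul, nsmul_eq_mul]
      conv_lhs => rw [← ofAdd_toAdd m, ← ZMod.natCast_zmod_val (Multiplicative.toAdd m)]
      rw [← hn_def, ← Nat.div_add_mod n 2]
      congr 1
      have e : (2 * (n / 2) + n % 2) / 2 = n / 2 := by omega
      have e' : (2 * (n / 2) + n % 2) % 2 = n % 2 := by omega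
      rw [e, e']
      push_cast
      ring
    rcases Nat.mod_two_eq_zero_or_one n with h0 | h1
    · refine Or.inl ⟨(Multiplicative.ofAdd ((n / 2 : ℕ) : ZMod (2 ^ (a + 1))), v), ?_⟩
      rw [hi_apply, toAdd_ofAdd, hk4, hm, h0, pow_zero, mul_one]
    · refine Or.inr ⟨(Multiplicative.ofAdd ((n / 2 : ℕ) : ZMod (2 ^ (a + 1))), v), ?_⟩
      rw [hi_apply, toAdd_ofAdd, hk4, hy, SemidirectProduct.mul_def]
      refine SemidirectProduct.ext ?_ ?_
      · simp
      · simpa [h1] using hm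
  -- conjugation by `y` inverts the `ℤ/p`-factor; `y² = i(1, 0)`
  let θ : Multiplicative (ZMod (2 ^ (a + 1))) × Multiplicative (ZMod p) ≃*
      Multiplicative (ZMod (2 ^ (a + 1))) × Multiplicative (ZMod p) :=
    MulEquiv.prodCongr (MulEquiv.refl _) (MulEquiv.inv _)
  have hθ_apply : ∀ w, θ w = (w.1, w.2⁻¹) := fun w => rfl
  have hθ : ∀ w, y * i w = i (θ w) * y := fun ⟨t, v⟩ => by
    rw [hi_apply, hi_apply, hθ_apply, hy, SemidirectProduct.mul_def, SemidirectProduct.mul_def]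
    refine SemidirectProduct.ext ?_ ?_
    · simp [hφ]
    · simp [mul_comm]
  set q : Multiplicative (ZMod (2 ^ (a + 1))) × Multiplicative (ZMod p) := (Multiplicative.ofAdd 1, 1) with hq_def
  have h1val : (1 : ZMod (2 ^ (a + 1))).val = 1 := ZMod.val_one _
  have h2a : 2 ^ a < 2 ^ (a + 1) := Nat.pow_lt_pow_right (by norm_num) (by omega)
  have h2val : (((2 ^ a : ℕ) : ZMod (2 ^ (a + 1)))).val = 2 ^ a := ZMod.val_natCast_of_lt h2a
  have hyy : y * y = i q := by
    rw [hi_apply, hq_def, toAdd_ofAdd, h1val, pow_one, hy, SemidirectProduct.mul_def]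
    refine SemidirectProduct.ext ?_ ?_
    · simp
    · change Multiplicative.ofAdd (1 : ZMod (2 ^ (a + 2))) * Multiplicative.ofAdd 1 = Multiplicative.ofAdd 2
      rw [← ofAdd_add]; norm_num
  set c : Multiplicative (ZMod (2 ^ (a + 1))) × Multiplicative (ZMod p) :=
    (Multiplicative.ofAdd (((2 ^ a : ℕ) : ZMod (2 ^ (a + 1)))), 1) with hc_def
  have hic : i c = SemidirectProduct.inr (Multiplicative.ofAdd ((2 ^ (a + 1) : ℕ) : ZMod (2 ^ (a + 2)))) := by
    rw [hi_apply, hc_def, toAdd_ofAdd, h2val, hpow2, ← hK']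
    rfl
  have h22 : (((2 ^ a : ℕ) : ZMod (2 ^ (a + 1)))) + ((2 ^ a : ℕ) : ZMod (2 ^ (a + 1))) = 0 := by
    rw [← Nat.cast_add, ← two_mul, ← hK', ZMod.natCast_self]
  have hcc : c * c = 1 := by
    rw [hc_def, Prod.mk_mul_mk, mul_one, ← ofAdd_add, h22]; rfl
  have hθc : θ c = c := by rw [hθ_apply, hc_def, inv_one]
  -- the two sheets of `S`
  set S₁ : Finset (Multiplicative (ZMod (2 ^ (a + 1))) × Multiplicative (ZMod p)) :=
    Finset.univ.filter fun w => i w ∈ S with hS₁_def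
  set S₂ : Finset (Multiplicative (ZMod (2 ^ (a + 1))) × Multiplicative (ZMod p)) :=
    Finset.univ.filter fun w => i w * y ∈ S with hS₂_def
  have hS₁ : ∀ w, w ∈ S₁ ↔ i w ∈ S := fun w => by simp [hS₁_def]
  have hS₂ : ∀ w, w ∈ S₂ ↔ i w * y ∈ S := fun w => by simp [hS₂_def]
  have hS₁cm : IsCMTypeWith c (↑S₁ : Set (Multiplicative (ZMod (2 ^ (a + 1))) × Multiplicative (ZMod p))) := by
    refine ⟨fun w => ?_, fun g w => ?_, fun w => ?_⟩
    · rw [Finset.mem_coe, Finset.mem_coe, hS₁, hS₁, smul_eq_mul, map_mul, hic, hScm, not_not]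
    · simp only [smul_eq_mul, mul_left_comm]
    · rw [smul_eq_mul, smul_eq_mul, ← mul_assoc, hcc, one_mul]
  have hS₂cm : IsCMTypeWith c (↑S₂ : Set (Multiplicative (ZMod (2 ^ (a + 1))) × Multiplicative (ZMod p))) := by
    refine ⟨fun w => ?_, fun g w => ?_, fun w => ?_⟩
    · rw [Finset.mem_coe, Finset.mem_coe, hS₂, hS₂, smul_eq_mul, map_mul, hic, mul_assoc, hScm, not_not]
    · simp only [smul_eq_mul, mul_left_comm]
    · rw [smul_eq_mul, smul_eq_mul, ← mul_assoc, hcc, one_mul]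
  -- the stabilising element `γ^{2^{a+1}} = (0, 2^{a+1}) ↦ u^{2^{a+1}} = inl 2^{a+1}`
  have h4 : ((Multiplicative.ofAdd (1 : ZMod (2 ^ (a + 1))), Multiplicative.ofAdd (1 : ZMod p)) :
      Multiplicative (ZMod (2 ^ (a + 1))) × Multiplicative (ZMod p)) ^ 2 ^ (a + 1) =
      (1, Multiplicative.ofAdd (((2 ^ (a + 1) : ℕ) : ZMod p))) := by
    rw [Prod.pow_mk, ← ofAdd_nsmul, ← ofAdd_nsmul, nsmul_eq_mul, nsmul_eq_mul, mul_one, mul_one, ZMod.natCast_self]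
    rfl
  have hγ4 : i (((Multiplicative.ofAdd (1 : ZMod (2 ^ (a + 1))), Multiplicative.ofAdd (1 : ZMod p)) :
      Multiplicative (ZMod (2 ^ (a + 1))) × Multiplicative (ZMod p)) ^ 2 ^ (a + 1)) =
      SemidirectProduct.inl (Multiplicative.ofAdd (((2 ^ (a + 1) : ℕ) : ZMod p))) := by
    rw [h4, hi_apply, toAdd_one, ZMod.val_zero, pow_zero]
    rfl
  have hcomm : ∀ w, i (((Multiplicative.ofAdd (1 : ZMod (2 ^ (a + 1))), Multiplicative.ofAdd (1 : ZMod p)) :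
      Multiplicative (ZMod (2 ^ (a + 1))) × Multiplicative (ZMod p)) ^ 2 ^ (a + 1)) * i w =
      i (w * ((Multiplicative.ofAdd (1 : ZMod (2 ^ (a + 1))), Multiplicative.ofAdd (1 : ZMod p)) :
      Multiplicative (ZMod (2 ^ (a + 1))) × Multiplicative (ZMod p)) ^ 2 ^ (a + 1)) := fun w => by
    rw [← map_mul, mul_comm w]
  -- the determinant does not vanish on odd characters
  have hdet : ∀ χ : AddChar (Additive (Multiplicative (ZMod (2 ^ (a + 1))) × Multiplicative (ZMod p))) ℂ,
      χ (Additive.ofMul c) = -1 →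
      (∑ s ∈ S₁, χ (Additive.ofMul s)) * (∑ s ∈ S₁, χ (Additive.ofMul (θ s))) -
        χ (Additive.ofMul q) * ((∑ t ∈ S₂, χ (Additive.ofMul t)) * (∑ t ∈ S₂, χ (Additive.ofMul (θ t)))) ≠ 0 := by
    intro χ hχ hΔ
    simp_rw [hθ_apply] at hΔ
    obtain ⟨h1, h2⟩ := sums_eq_zero_of_det_eq_zero χ M ρ hM hρ2 hρp hN hχ S₁ S₂ hΔ
    have hp1 := mul_pow_mem_iff_of_sum_eq_zero (G := Multiplicative (ZMod (2 ^ (a + 1))) × Multiplicative (ZMod p))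
      (a := a) (q := p) hp hp2 (orderOf_gamma hp2) (mem_powers_gamma hp2) hS₁cm χ hχ h1
    have hp2' := mul_pow_mem_iff_of_sum_eq_zero (G := Multiplicative (ZMod (2 ^ (a + 1))) × Multiplicative (ZMod p))
      (a := a) (q := p) hp hp2 (orderOf_gamma hp2) (mem_powers_gamma hp2) hS₂cm χ hχ h2
    apply hstab
    intro w
    rw [← hγ4]
    rcases hcov w with ⟨u, rfl⟩ | ⟨u, rfl⟩
    · rw [← hS₁, hp1 u, hS₁, ← hcomm]
    · rw [← hS₂, hp2' u, hS₂, ← mul_assoc, hcomm]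
  exact TwoSheet.eq_zero_of_twoSheet i hi y hx hcov θ hθ q hyy hcc hθc S S₁ S₂ hS₁ hS₂ hdet b
    (fun g => by rw [hic]; exact hb g) hann

end Model

end Summit.HodgeConjecture.CorCM.GaloisCyclicSemidirectTwoPower

end
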